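import Mathlib.Combinatorics.SimpleGraph.AdjMatrix
import Mathlib.Combinatorics.SimpleGraph.Finite
import Mathlib.Analysis.Normed.Algebra.MatrixExponential
import Mathlib.MeasureTheory.Integral.IntervalIntegral.Basic
import Mathlib.Logic.Equiv.Fin.Rotate
import Mathlib.Data.Fintype.CardEmbedding
import Literature.Computability.Complexity.Oracle
import HarnessLib

/-!
# The glued-trees graphs, their name oracle, the quantum-walk hitting bound and the classical query lower bound (Childs–Cleve–Deotto–Farhi–Gutmann–Spielman 2003)

Source read: A. M. Childs, R. Cleve, E. Deotto, E. Farhi, S. Gutmann, D. A. Spielman,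
*Exponential algorithmic speedup by a quantum walk*, STOC 2003, arXiv:quant-ph/0209131
(`paper:arxiv-quant-ph_0209131`), verbatim:

* §2 (pp. 3–4): "The vertices are named with randomly chosen `2n`-bit strings, and the oracle
  only refers to the vertices by their names. […] The oracle takes a `2n`-bit string as input,
  and if that name corresponds to an actual vertex in the graph, the oracle outputs the names of
  the adjacent vertices. There are also two identifiable vertices called ENTRANCE and EXIT […]
  the left root and the right root of the trees, respectively. The traversal problem is: Given an
  oracle for the graph and the name of the ENTRANCE, find the name of the EXIT. […] The graph
  [`G'_n`] again consists of two balanced binary trees of height `n`, but instead of identifying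
  the leaves, they are connected by a random cycle that alternates between the leaves of the two
  trees. In other words, we choose a leaf on the left at random and connect it to a leaf on the
  right chosen at random. Then we connect the latter to a leaf on the left chosen randomly among
  the remaining ones. We continue with this procedure, alternating sides, until every leaf on the
  left is connected to two leaves on the right (and vice versa)."
* §3.1 (p. 5): "we define a quantum walk in terms of a Hamiltonian with matrix elements
  `⟨a|H|a'⟩ = γ` (`aa' ∈ G`), `0` otherwise. In other words, `H` is the adjacency matrix of the
  graph times `γ`"; §3.3 (p. 8): "For simplicity, we set `γ = 1/√2`"; §3.4 (p. 9): "For the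
  purpose of this proof, it will be more convenient to consider the graph `G'_{n-1}`, which
  reduces to a line with `2n` vertices. […] The ENTRANCE vertex corresponds to `|col 1⟩` and the
  EXIT vertex to `|col 2n⟩`. **Lemma 1.** Consider the quantum walk in `G'_{n-1}` starting at the
  ENTRANCE. Let the walk run for a time `t` chosen uniformly in `[0, τ]` and then measure in the
  computational basis. If `τ ≥ 4n/(ε ΔE)` for any constant `ε > 0`, where `ΔE` is the magnitude of
  the smallest gap between any pair of eigenvalues of the Hamiltonian, then the probability of
  finding the EXIT is greater than `(1/2n)(1 - ε)`" (proof: this probability is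
  `(1/τ) ∫₀^τ |⟨col 2n| e^{-iHt} |col 1⟩|² dt`); "**Lemma 2.** […] `ΔE > 2π²/((1+√2)n³) + O(1/n⁴)`";
  p. 10: "**Theorem 3.** For `n` sufficiently large, running the quantum walk for a time chosen
  uniformly in `[0, n⁴/(2ε)]` and then measuring in the computational basis yields a probability
  of finding the EXIT that is greater than `(1/2n)(1 - ε)`."
* §4 (p. 11): "**Game 1.** The oracle contains a random set of names for the vertices of the
  randomly chosen graph `G'_n` such that each vertex has a distinct `2n`-bit string as its name
  and the ENTRANCE vertex has the name `0`. In addition, the edges of the graph are randomly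
  colored as described above. At each step, the algorithm sends a `2n`-bit string to the oracle,
  and if there exists a vertex with that name, the oracle returns the names of the neighbors of
  that vertex and the colors of the edges that join them. The algorithm wins if it ever sends the
  oracle the name of the EXIT vertex." p. 13: "**Theorem 9.** Any classical algorithm that makes
  at most `2^{n/6}` queries to the oracle finds the EXIT with probability at most `4 · 2^{-n/6}`."

## Lean rendering

* `GluedTrees.Vertex n = Bool × Σ j : Fin (n+1), Fin (2^j)`: side (`false` = ENTRANCE tree,
  `true` = EXIT tree), depth `j`, position `i` in binary-heap indexing (the parent of `(j+1, i)`
  is `(j, i/2)`; the leaves are the `2ⁿ` vertices of depth `n`). The random alternating cycle is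
  parametrised by a `GluedTrees.CycleDatum n = Perm (Fin 2ⁿ) × Perm (Fin 2ⁿ)`, `σ = (e, f)`: the
  orders in which the left leaves `e 0, e 1, …` and the right leaves `f 0, f 1, …` are visited,
  with edges `e k — f k` and `f k — e (k+1 mod 2ⁿ)`; the printed sequential sampling is exactly a
  uniformly random pair of orders, so "random `G'_n`" is the uniform distribution on `CycleDatum n`
  (`GluedTrees.graph n σ : SimpleGraph (Vertex n)`; for `n = 0` the two doubled cycle edges collapse
  to the single edge ENTRANCE — EXIT of the simple graph, a degenerate case outside the theorems).
* Names have length `N` (a parameter; `N = 2n` in the paper and in both facts): a naming is an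
  injection `ν : Vertex n ↪ (Fin N → Bool)`. The oracle answer on a name `a` is the SET of the
  names of the neighbours (`GluedTrees.nbrNames`, a `Finset`; empty — the INVALID answer — when
  `a` names no vertex), listed in increasing order of binary value (`gluedTreesOracle`, the requested
  `nbr : {0,1}^N → List ({0,1}^N)`): the printed oracle "returns the names of the
  neighbors" with no order information, and an order depending on the graph (parent first, say)
  would let a classical algorithm walk to the EXIT in `O(n)` queries, so a canonical order of the
  name set is the faithful reading. As a string oracle for the tree's transcript algorithms
  (`Complexity.Oracle = List Bool → List Bool`, `Complexity.OracleAlg`): a query of length `≠ N`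
  or naming no vertex is answered `[]`, otherwise by the concatenation of the sorted neighbour
  names (`GluedTrees.strOracle`).
* Theorem 9 (`ChildsEtAl2003_thm9`): the sample space is `Outcome n = CycleDatum n × Naming n`,
  `Naming n` the injective namings by `2n`-bit strings with `ν(ENTRANCE) = 0^{2n}` (Game 1), with
  the uniform (counting) measure; a classical algorithm is ANY deterministic transcript algorithm
  `M : OracleAlg β` with any input/advice string `x` (computationally unbounded — the printed proof
  is purely query-counting), run for `t` rounds, so that its transcript `M.queries O t x` has at
  most `t` queries; it "finds the EXIT" on the outcome `(σ, ν)` iff the string `ν(EXIT)` is one of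
  these queries ("wins if it ever sends the oracle the name of the EXIT"). The fact bounds the
  fraction of outcomes on which this happens by `4 · 2^{-n/6}` whenever `t ≤ 2^{n/6}`. This is the
  printed theorem for deterministic algorithms and the COLOURLESS oracle — a corollary of the
  printed statement, never stronger: a randomised algorithm's success probability is an average
  of deterministic ones, and an algorithm against the colourless oracle is an algorithm for Game 1
  that ignores the colours (Lemma 5 removes them anyway). For `n ≤ 1` there is no injective naming
  by `2n` bits (`2^{n+2} - 2 > 2^{2n}`), `Outcome n` is empty and the success fraction is the junk
  value `0` (documented; the theorem is asymptotic in `n`).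
* Theorem 3 (`ChildsEtAl2003_thm3`): the walk on `G'_n` is `e^{-iHt}` with
  `H = (1/√2) · A(G'_n)` (`GluedTrees.hamiltonian`, Mathlib `SimpleGraph.adjMatrix` and the matrix
  exponential `NormedSpace.exp`), the probability of finding the EXIT at time `t` starting from
  the ENTRANCE is `|⟨EXIT| e^{-iHt} |ENTRANCE⟩|²` (`GluedTrees.exitAmplitude`), and "time chosen
  uniformly in `[0, τ]`" is the average `(1/τ) ∫₀^τ`. The printed theorem is phrased (§3.4) for
  `G'_{n-1}`, whose column space is a line of `2n` vertices; it is stated below for `G'_n` with the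
  printed `n` replaced by `n + 1` throughout (`τ = (n+1)⁴/(2ε)`, bound `(1 - ε)/(2(n+1))`) — the
  same statement. "For `n` sufficiently large" is rendered with the threshold allowed to depend on
  the constant `ε > 0` fixed beforehand (Lemma 1: "for any constant `ε > 0`"), the weaker reading.
  The bound holds for EVERY cycle datum `σ` (the column-space reduction is independent of `σ`).
* NOT vendored here: the efficient simulation of the walk with `poly(n)` calls to the coloured
  oracle `v_c` (§3.2, no numbered statement; its formal home is the circuit-model item
  `WbwSuccinctWalk` of route `Summits/QuantumAdvantage/QuantumAdvantage/Theses/WhiteBoxWalk`), the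
  edge colourings, and Lemmas 1, 2, 4–8.

## References

* [ChildsEtAl2003] A. M. Childs, R. Cleve, E. Deotto, E. Farhi, S. Gutmann, D. A. Spielman,
  Exponential algorithmic speedup by a quantum walk, STOC 2003, 59–68 (arXiv:quant-ph/0209131),
  §2, §3.1, §3.4 (Lemma 1, Lemma 2, Theorem 3), §4 (Game 1, Theorem 9).
-/

noncomputable section

open Literature.Computability.Complexity

namespace Literature.Computability.QuantumComplexity

namespace GluedTrees

/-! ### The graphs `G'_n` -/

/-- The vertices of the glued-trees graph `G'_n`: a side (`false` = the ENTRANCE (left) tree,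
`true` = the EXIT (right) tree), a depth `j ≤ n` and a position `i < 2ʲ` at that depth
(binary-heap indexing: the children of `(j, i)` are `(j+1, 2i)` and `(j+1, 2i+1)`).
[cite: ChildsEtAl2003, §2] -/
abbrev Vertex (n : ℕ) : Type := Bool × Σ j : Fin (n + 1), Fin (2 ^ (j : ℕ))

variable {n : ℕ}

/-- The ENTRANCE: the root of the left tree. [cite: ChildsEtAl2003, §2] -/
def entrance (n : ℕ) : Vertex n := (false, ⟨0, ⟨0, Nat.two_pow_pos _⟩⟩)

/-- The EXIT: the root of the right tree. [cite: ChildsEtAl2003, §2] -/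
def exit (n : ℕ) : Vertex n := (true, ⟨0, ⟨0, Nat.two_pow_pos _⟩⟩)

/-- The `i`-th leaf (depth `n`) of the left tree. [cite: ChildsEtAl2003, §2] -/
def leafL (n : ℕ) (i : Fin (2 ^ n)) : Vertex n := (false, ⟨Fin.last n, i⟩)

/-- The `i`-th leaf (depth `n`) of the right tree. [cite: ChildsEtAl2003, §2] -/
def leafR (n : ℕ) (i : Fin (2 ^ n)) : Vertex n := (true, ⟨Fin.last n, i⟩)

/-- The datum of the alternating cycle joining the leaves: the order `e` in which the left leaves
and the order `f` in which the right leaves are visited (`σ = (e, f)`; edges `e k — f k` and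
`f k — e (k+1)`), i.e. the printed sampling "choose a leaf on the left at random and connect it
to a leaf on the right chosen at random. Then we connect the latter to a leaf on the left chosen
randomly among the remaining ones […]"; the uniform distribution on this type is the printed
distribution of `G'_n`. [cite: ChildsEtAl2003, §2] -/
abbrev CycleDatum (n : ℕ) : Type := Equiv.Perm (Fin (2 ^ n)) × Equiv.Perm (Fin (2 ^ n))

/-- Tree edges, directed child → parent: `u` is a child of `v` (same side, depth one more,
position halved). [cite: ChildsEtAl2003, §2] -/
def IsChild (u v : Vertex n) : Prop :=
  u.1 = v.1 ∧ (u.2.1 : ℕ) = (v.2.1 : ℕ) + 1 ∧ (u.2.2 : ℕ) / 2 = (v.2.2 : ℕ)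

/-- `IsChild` is decidable (a conjunction of equalities of naturals and Booleans). [folklore] -/
instance : DecidableRel (IsChild (n := n)) := fun u v ↦ by
  unfold IsChild; infer_instance

/-- Cycle edges, directed along the alternating cycle: `e k → f k` and `f k → e (k + 1 mod 2ⁿ)`.
[cite: ChildsEtAl2003, §2] -/
def IsGlued (σ : CycleDatum n) (u v : Vertex n) : Prop :=
  ∃ k : Fin (2 ^ n), (u = leafL n (σ.1 k) ∧ v = leafR n (σ.2 k)) ∨
    (u = leafR n (σ.2 k) ∧ v = leafL n (σ.1 (finRotate (2 ^ n) k)))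

/-- `IsGlued σ` is decidable (a bounded existential over `Fin 2ⁿ`). [folklore] -/
instance (σ : CycleDatum n) : DecidableRel (IsGlued σ) := fun u v ↦ by
  unfold IsGlued; infer_instance

/-- **The glued-trees graph `G'_n(σ)`**: two complete binary trees of height `n` whose leaves are
joined by the alternating cycle `σ` (the symmetric, irreflexive closure of `IsChild ∪ IsGlued σ`).
[cite: ChildsEtAl2003, §2] -/
def graph (n : ℕ) (σ : CycleDatum n) : SimpleGraph (Vertex n) :=
  SimpleGraph.fromRel fun u v ↦ IsChild u v ∨ IsGlued σ u v

/-- Adjacency in `G'_n(σ)` is decidable (so that neighbourhoods are `Finset`s and small cases are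
checked by `decide`). [folklore] -/
instance (σ : CycleDatum n) : DecidableRel (graph n σ).Adj := fun u v ↦
  inferInstanceAs (Decidable (u ≠ v ∧ ((IsChild u v ∨ IsGlued σ u v) ∨ (IsChild v u ∨ IsGlued σ v u))))

/-- Adjacency in `G'_n(σ)`, unfolded. [cite: ChildsEtAl2003, §2] -/
theorem graph_adj (σ : CycleDatum n) (u v : Vertex n) :
    (graph n σ).Adj u v ↔ u ≠ v ∧ ((IsChild u v ∨ IsGlued σ u v) ∨ (IsChild v u ∨ IsGlued σ v u)) :=
  Iff.rfl

/-- The ENTRANCE and the EXIT are distinct vertices. [cite: ChildsEtAl2003, §2] -/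
theorem entrance_ne_exit (n : ℕ) : entrance n ≠ exit n := by
  simp [entrance, exit]

/-! ### Names and the oracle -/

variable {N : ℕ}

/-- The binary value of a name `a ∈ {0,1}^N` (bit `i` has weight `2ⁱ`); used only to list name
sets in a canonical order. [cite: ChildsEtAl2003, §2] -/
def nameVal (a : Fin N → Bool) : ℕ := ∑ i : Fin N, (a i).toNat * 2 ^ (i : ℕ)

/-- The name of length `N` with binary value `m` (inverse of `nameVal` on values `< 2^N`).
[cite: ChildsEtAl2003, §2] -/
def nameOfVal (N : ℕ) (m : ℕ) : Fin N → Bool := fun i ↦ m.testBit i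

/-- **The oracle answer as a set**: for the naming `ν` (an injection of the vertices into
`{0,1}^N`) and a string `a ∈ {0,1}^N`, the set of names of the neighbours in `G'_n(σ)` of the
vertex named `a`; empty if `a` names no vertex ("if that name corresponds to an actual vertex in
the graph, the oracle outputs the names of the adjacent vertices"). [cite: ChildsEtAl2003, §2 and §4 Game 1] -/
def nbrNames (σ : CycleDatum n) (ν : Vertex n ↪ (Fin N → Bool)) (a : Fin N → Bool) : Finset (Fin N → Bool) :=
  (Finset.univ.filter fun v ↦ ν v = a).biUnion fun v ↦ ((graph n σ).neighborFinset v).map ν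

end GluedTrees

/-- **The glued-trees oracle** `nbr : {0,1}^N → List ({0,1}^N)` of the instance `(σ, ν)` (graph
`G'_n(σ)`, injective naming `ν` by `N`-bit strings): the names of the (at most three) neighbours of
the vertex named `a`, listed in increasing order of binary value (a canonical order carrying no
information beyond the SET of names `GluedTrees.nbrNames σ ν a`, as in the printed oracle, which
"outputs the names of the adjacent vertices"), and the fixed INVALID answer `[]` when `a` names no
vertex. [cite: ChildsEtAl2003, §2 and §4 Game 1] -/
def gluedTreesOracle {n N : ℕ} (σ : GluedTrees.CycleDatum n) (ν : GluedTrees.Vertex n ↪ (Fin N → Bool))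
    (a : Fin N → Bool) : List (Fin N → Bool) :=
  (((GluedTrees.nbrNames σ ν a).image GluedTrees.nameVal).sort (· ≤ ·)).map (GluedTrees.nameOfVal N)

namespace GluedTrees

variable {n N : ℕ}

/-- The same oracle on bit strings, for the tree's transcript algorithms
(`Complexity.Oracle = List Bool → List Bool`): a query of length `N` naming a vertex is answered
by the concatenation of the sorted `N`-bit neighbour names; any other query by `[]`.
[cite: ChildsEtAl2003, §2 and §4 Game 1] -/
def strOracle (σ : CycleDatum n) (ν : Vertex n ↪ (Fin N → Bool)) : Oracle := fun q ↦
  if h : q.length = N then ((gluedTreesOracle σ ν fun i ↦ q.get (i.cast h.symm)).map List.ofFn).flatten else []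

/-- **The traversal problem, solved**: an answer string solves the instance `(σ, ν)` iff it is
the name of the EXIT ("Given an oracle for the graph and the name of the ENTRANCE, find the name
of the EXIT"). [cite: ChildsEtAl2003, §2] -/
def SolvesTraversal (ν : Vertex n ↪ (Fin N → Bool)) (out : List Bool) : Prop :=
  out = List.ofFn (ν (exit n))

/-! ### Theorem 9: the classical query lower bound -/

/-- The namings of Game 1: injective namings of the vertices of `G'_n` by `2n`-bit strings with
`ν(ENTRANCE) = 0^{2n}`. Empty for `n ≤ 1` (`2^{n+2} - 2 > 2^{2n}` vertices). [cite: ChildsEtAl2003, §4 Game 1] -/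
def Naming (n : ℕ) : Type :=
  {ν : Vertex n ↪ (Fin (2 * n) → Bool) // ν (entrance n) = fun _ ↦ false}

/-- `Naming n` is a finite type (injections between finite types with a decidable side condition).
[folklore] -/
instance : Fintype (Naming n) := by unfold Naming; infer_instance

/-- The sample space of Game 1 (without colours): a cycle datum and a naming, both uniform.
[cite: ChildsEtAl2003, §4 Game 1] -/
abbrev Outcome (n : ℕ) : Type := CycleDatum n × Naming n

/-- The deterministic transcript algorithm `M` with input/advice `x`, run for `t` rounds against
the oracle of the outcome `ω = (σ, ν)`, **finds the EXIT**: the string `ν(EXIT)` is one of its (at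
most `t`) queries ("The algorithm wins if it ever sends the oracle the name of the EXIT vertex").
[cite: ChildsEtAl2003, §4 Game 1] -/
def FindsExit {β : Type} (M : OracleAlg β) (x : List Bool) (t : ℕ) (ω : Outcome n) : Prop :=
  List.ofFn (ω.2.1 (exit n)) ∈ M.queries (strOracle ω.1 ω.2.1) t x

/-- Finding the EXIT is a decidable event (membership in the finite query transcript). [folklore] -/
instance {β : Type} (M : OracleAlg β) (x : List Bool) (t : ℕ) : DecidablePred (FindsExit (n := n) M x t) :=
  fun ω ↦ by unfold FindsExit; infer_instance

/-- The success probability of `(M, x)` within `t` rounds: the fraction of outcomes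
`(σ, ν) ∈ Outcome n` (uniform graph, uniform naming) on which it finds the EXIT. Junk value `0`
when `Outcome n` is empty (`n ≤ 1`). [cite: ChildsEtAl2003, §4 (success probability of Game 1)] -/
def findProb (n : ℕ) {β : Type} (M : OracleAlg β) (x : List Bool) (t : ℕ) : ℝ :=
  ((Finset.univ.filter (FindsExit (n := n) M x t)).card : ℝ) / Fintype.card (Outcome n)

/-- The success probability is non-negative. [cite: ChildsEtAl2003, §4] -/
theorem findProb_nonneg (n : ℕ) {β : Type} (M : OracleAlg β) (x : List Bool) (t : ℕ) :
    0 ≤ findProb n M x t := by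
  unfold findProb; positivity

/-- The success probability is at most `1`. [cite: ChildsEtAl2003, §4] -/
theorem findProb_le_one (n : ℕ) {β : Type} (M : OracleAlg β) (x : List Bool) (t : ℕ) :
    findProb n M x t ≤ 1 := by
  unfold findProb
  refine div_le_one_of_le₀ ?_ (Nat.cast_nonneg _)
  exact_mod_cast (Finset.card_filter_le _ _).trans (Finset.card_univ (α := Outcome n)).le

end GluedTrees

/-- **Childs–Cleve–Deotto–Farhi–Gutmann–Spielman (2003), Theorem 9 (classical lower bound for
the glued-trees traversal problem), deterministic/colourless form.** "Any classical algorithm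
that makes at most `2^{n/6}` queries to the oracle finds the EXIT with probability at most
`4 · 2^{-n/6}`" — the oracle and the winning condition being those of Game 1 (random `G'_n`,
random distinct `2n`-bit names with ENTRANCE named `0^{2n}`, win = ever querying the EXIT's
name). Rendering (module docstring): for every deterministic transcript algorithm
`M : OracleAlg β`, every input string `x` and every round budget `t ≤ 2^{n/6}`, the fraction of
outcomes `(σ, ν) ∈ GluedTrees.Outcome n` on which `ν(EXIT)` occurs among the queries
`M.queries (GluedTrees.strOracle σ ν) t x` is at most `4 · 2^{-n/6}`. Deterministic algorithms and
the colourless oracle make this a corollary of the printed theorem (randomised algorithms average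
deterministic ones; the colours can be ignored), never a strengthening. Statement only (proof:
Games 1–5, Lemmas 4–8, pp. 11–13: unguessable names, simulable colours, and a random-embedding
argument showing that `2^{n/6}` queries see a cycle or reach depth `n/2` of the EXIT tree with
probability `≤ 3 · 2^{-n/6}`). [cite: ChildsEtAl2003, Theorem 9 and Game 1 (§4)] -/
def ChildsEtAl2003_thm9 : Prop :=
  ∀ (n : ℕ) {β : Type} (M : OracleAlg β) (x : List Bool) (t : ℕ),
    (t : ℝ) ≤ (2 : ℝ) ^ ((n : ℝ) / 6) →
      GluedTrees.findProb n M x t ≤ 4 * (2 : ℝ) ^ (-((n : ℝ) / 6))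

namespace GluedTrees

/-! ### Theorem 3: the quantum walk hits the EXIT -/

variable {n : ℕ}

/-- The quantum-walk Hamiltonian of `G'_n(σ)`: `H = γ · A(G'_n)` with the adjacency matrix `A`
and `γ = 1/√2` ("`H` is the adjacency matrix of the graph times `γ`"; "we set `γ = 1/√2`").
[cite: ChildsEtAl2003, §3.1 and §3.3] -/
def hamiltonian (n : ℕ) (σ : CycleDatum n) : Matrix (Vertex n) (Vertex n) ℂ :=
  ((Real.sqrt 2)⁻¹ : ℂ) • (graph n σ).adjMatrix ℂ

/-- The amplitude `⟨EXIT| e^{-iHt} |ENTRANCE⟩` of the continuous-time quantum walk started at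
the ENTRANCE, at time `t` (matrix exponential `NormedSpace.exp`); its squared modulus is the
probability of finding the EXIT when measuring in the vertex basis at time `t`.
[cite: ChildsEtAl2003, §3.1 and §3.4 (proof of Lemma 1)] -/
def exitAmplitude (n : ℕ) (σ : CycleDatum n) (t : ℝ) : ℂ :=
  NormedSpace.exp ((-(t : ℂ) * Complex.I) • hamiltonian n σ) (exit n) (entrance n)

end GluedTrees

/-- **Childs–Cleve–Deotto–Farhi–Gutmann–Spielman (2003), Theorem 3 (the quantum walk traverses
the glued trees in polynomial time).** "For `n` sufficiently large, running the quantum walk for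
a time chosen uniformly in `[0, n⁴/(2ε)]` and then measuring in the computational basis yields a
probability of finding the EXIT that is greater than `(1/2n)(1 - ε)`" — for the walk
`e^{-iHt}`, `H = (1/√2)A`, on the graph `G'_{n-1}` (§3.4: "it will be more convenient to consider
the graph `G'_{n-1}`, which reduces to a line with `2n` vertices"), started at the ENTRANCE, for
any constant `ε > 0` (Lemma 1) and every graph of the family. Rendering (module docstring): for
every `ε > 0` there is `n₀` such that for all `n ≥ n₀` and EVERY cycle datum `σ`, the time-averaged
hitting probability `(1/τ) ∫₀^τ |⟨EXIT| e^{-iHt} |ENTRANCE⟩|² dt` on `G'_n(σ)` with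
`τ = (n+1)⁴/(2ε)` exceeds `(1 - ε)/(2(n+1))` — the printed statement with its `n` (for `G'_{n-1}`)
written `n + 1` (for `G'_n`). Statement only (proof: reduction to the column space, a line of
`2n+2` sites with a `√2` defect, Lemma 1 (`τ ≥ 4n/(εΔE)` suffices, by Cauchy–Schwarz and the
reflection symmetry) and Lemma 2 (spectral gap `ΔE > 8/n³` for large `n`)).
[cite: ChildsEtAl2003, Theorem 3, Lemma 1 and Lemma 2 (§3.4)] -/
def ChildsEtAl2003_thm3 : Prop :=
  ∀ ε : ℝ, 0 < ε → ∃ n₀ : ℕ, ∀ n : ℕ, n₀ ≤ n → ∀ σ : GluedTrees.CycleDatum n,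
    (1 - ε) / (2 * ((n : ℝ) + 1)) <
      (2 * ε / ((n : ℝ) + 1) ^ 4) *
        ∫ t in (0 : ℝ)..(((n : ℝ) + 1) ^ 4 / (2 * ε)), ‖GluedTrees.exitAmplitude n σ t‖ ^ 2

end Literature.Computability.QuantumComplexity

end
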